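import Literature.AlgebraicGeometry.HodgeTheory.SupportedHodgeClassesAlgebraic
import Literature.AlgebraicGeometry.HodgeTheory.SaitoGrFDeRhamCurveNetHolds
import Literature.AlgebraicGeometry.HodgeTheory.HodgeRiemannPolarizabilityProofs
import Literature.AlgebraicGeometry.HodgeTheory.GysinKernelProofs
import Literature.AlgebraicGeometry.Motives.ComplexPointsOrientation
import Literature.AlgebraicGeometry.Resolution.ProjectiveResolutionProofs
import Literature.AlgebraicTopology.SingularHomology.GysinMapSupportProofs
import HarnessLib

/-!
# `stub_verticalOfBelow` — VERTICAL HODGE CLASSES ON A NETTED `2m`-FOLD ARE ALGEBRAIC, GRANTED THE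
# HODGE CONJECTURE IN ALL DIMENSIONS `< 2m`

Registered stub `stub_verticalOfBelow` of line `birth` (skeleton v2) of crux `SummitGrantedFourfolds`
(stmt-HodgeConjecture-14600, route `NoetherLefschetzOneUp` of `HodgeConjecture`). Statement: for every
level `m`, if every rational `(p,p)`-class on every smooth projective complex variety `W` of dimension
`d < 2m` lies in `algebraicClasses W p`, then for `X` smooth projective of dimension `2m` over `ℂ` and
`f : X ⟶ ℙ²` surjective on points, the span of the rational `(m,m)`-classes `c ∈ H^{2m}(X(ℂ); ℂ)`
vanishing on `(X ∖ f⁻¹T)(ℂ)` for some Zariski-closed `T ⊊ ℙ²` (the VERTICAL classes of the net) lies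
in `algebraicClasses X m`. The case `m = 2` (where the hypothesis is Lefschetz `(1,1)` on threefolds
and surfaces) is the route's support item `VerticalHodgeAlgebraic`
(`Theorems/NoetherLefschetzOneUpVerticalHodgeAlgebraic.lean`).

PROOF (C. Voisin, Ann. Sci. ÉNS 46 (2013), proof of Lemma 2.1, with the Lefschetz-`(1,1)` step
replaced by the granted Hodge conjecture below the dimension; all inputs are THEOREMS of the tree).
Fix `c` rational of type `(m,m)` dying on `(X ∖ f⁻¹T)(ℂ)`.

1. `Z := f⁻¹T` is Zariski-closed (`f` is continuous) and `≠ X` (`f` is onto and `T ≠ ℙ²`).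
2. Deligne descent off the proper closed subset `Z`
   (`mem_iSup_map_complexGysin_of_restrictCompl_eq_zero_of_ne_univ`,
   `HodgeTheory/SupportedHodgeClassesAlgebraic`): `c` is a `ℂ`-combination of Gysin images `g_* b`,
   `g : W ⟶ X` from smooth projective `W` of dimension `m' = 2m − e` with `1 ≤ e`, `d + e = m`, and
   `b ∈ H^{2d}(W(ℂ); ℂ)` rational of type `(d,d)` — Deligne, *Hodge III*, Cor. 8.2.8
   (`Deligne1974_ker_restrictCompl_eq_iSup_range_complexGysin_holds`), the lifting of Hodge classes
   along sums of Gysin morphisms by semisimplicity of polarisable Hodge structures, Voisin 2025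
   Cor. 2.12 (`Voisin2025_hodgeClass_lift_complexGysin_holds`), and projective Hironaka for the
   components of `Z` (`Resolution.Hironaka1964_projective_holds`, Kollár 2007 Thm. 3.27), relative to
   the orientation family chosen by `Motives.ComplexPoints.isOrientableOver` (every orientation family
   has Poincaré duality, `OrientationFamily.hasPoincareDuality`).
3. Each `b` is algebraic by the hypothesis, `dim W = 2m − e < 2m` since `e ≥ 1`.
4. Gysin images of algebraic classes are algebraic with the codimension shift `d + 2m = m + m'`
   (`complexGysin_mem_algebraicClasses`, from the support property of Gysin maps over a field,
   `gysinMap_restrictCompl_eq_zero_of_field ℂ`), so every `g_* b ∈ algebraicClasses X m`, hence `c`.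

No named fact is assumed; no `sorry`.

## References

* [DeligneHodgeIII1974] P. Deligne, *Théorie de Hodge III*, Publ. Math. IHÉS 44 (1974), Cor. 8.2.8.
* [Voisin2025] C. Voisin, *Hodge and generalized Hodge conjectures, coniveau and algebraic cycles*,
  J. Open Math. Probl. 1 (2025), Cor. 2.12.
* [Voisin2013GHCBloch] C. Voisin, Ann. Sci. ÉNS 46 (2013), Lemma 2.1 (proof).
* [Kollar2007] J. Kollár, *Lectures on Resolution of Singularities* (2007), Thm. 3.27.
-/

-- `Summit.HodgeConjecture.HodgeConjecture.Theorems` is the mandated namespace (single-problem summit),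
-- flagged by `linter.dupNamespace`; the lakefile turns the linter off tree-wide, restated here.
set_option linter.dupNamespace false

noncomputable section

open CategoryTheory AlgebraicGeometry
open Literature.AlgebraicGeometry Literature.AlgebraicGeometry.HodgeTheory
open Literature.AlgebraicTopology.SingularHomology

namespace Summit.HodgeConjecture.HodgeConjecture.Theorems

/-- **Vertical classes are algebraic, granted the Hodge conjecture below the dimension** — stub
`stub_verticalOfBelow` of line `birth` (v2) of crux `SummitGrantedFourfolds`: for `X` smooth
projective of dimension `2m` over `ℂ` and `f : X ⟶ ℙ²` surjective on points, if every rational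
`(p,p)`-class on every smooth projective complex variety of dimension `< 2m` is algebraic, then the
span of the rational `(m,m)`-classes dying on `(X ∖ f⁻¹T)(ℂ)` for some Zariski-closed `T ⊊ ℙ²` lies
in `algebraicClasses X m`. Proof (Voisin 2013, proof of Lemma 2.1): `f⁻¹T` is a proper closed subset
of `X`, so such a class is a `ℂ`-combination of Gysin images `g_* b`, `g : W ⟶ X`, `W` smooth
projective of dimension `2m − e`, `1 ≤ e`, `b` rational of type `(m − e, m − e)` (Deligne, Hodge III
Cor. 8.2.8; the semisimple lift, Voisin 2025 Cor. 2.12; projective Hironaka, Kollár Thm. 3.27 —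
`mem_iSup_map_complexGysin_of_restrictCompl_eq_zero_of_ne_univ` fed with the tree's discharges
`Deligne1974_ker_restrictCompl_eq_iSup_range_complexGysin_holds`,
`Voisin2025_hodgeClass_lift_complexGysin_holds`, `Resolution.Hironaka1964_projective_holds`, the
orientation family of `Motives.ComplexPoints.isOrientableOver` and
`OrientationFamily.hasPoincareDuality`); each `b` is algebraic by hypothesis (`dim W < 2m`), and
Gysin images of algebraic classes are algebraic (`complexGysin_mem_algebraicClasses`,
`gysinMap_restrictCompl_eq_zero_of_field ℂ`). [cite: DeligneHodgeIII1974, Cor. 8.2.8]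
[cite: Voisin2025, Cor. 2.12] [cite: Voisin2013GHCBloch, Lemma 2.1 (proof)]
[cite: Kollar2007, Thm. 3.27] -/
theorem stub_verticalOfBelow :
    ∀ ⦃m : ℕ⦄, (∀ ⦃d : ℕ⦄, d < 2 * m → ∀ ⦃W : Literature.AlgebraicGeometry.Motives.SchemeOver ℂ⦄, Literature.AlgebraicGeometry.Motives.IsSmoothProjective d W → ∀ (p : ℕ) (b : Literature.AlgebraicGeometry.HodgeTheory.complexBetti W (2 * p)), Literature.AlgebraicGeometry.HodgeTheory.IsRationalClass b → Literature.AlgebraicGeometry.HodgeTheory.IsOfHodgeType d W (2 * p) p p b → b ∈ Literature.AlgebraicGeometry.HodgeTheory.algebraicClasses W p) → ∀ ⦃X : Literature.AlgebraicGeometry.Motives.SchemeOver ℂ⦄ (f : X ⟶ Literature.AlgebraicGeometry.Motives.projectiveSpace 2 ℂ), Literature.AlgebraicGeometry.Motives.IsSmoothProjective (2 * m) X → Function.Surjective f.left.base → Submodule.span ℂ {c : Literature.AlgebraicGeometry.HodgeTheory.complexBetti X (2 * m) | Literature.AlgebraicGeometry.HodgeTheory.IsRationalClass c ∧ Literature.AlgebraicGeometry.HodgeTheory.IsOfHodgeType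 (2 * m) X (2 * m) m m c ∧ ∃ T : Set (Literature.AlgebraicGeometry.Motives.projectiveSpace 2 ℂ).left, IsClosed T ∧ T ≠ Set.univ ∧ Literature.AlgebraicGeometry.HodgeTheory.complexBetti.restrictCompl X (f.left.base ⁻¹' T) (2 * m) c = 0} ≤ Literature.AlgebraicGeometry.HodgeTheory.algebraicClasses X m := by
  intro m hbelow X f hX hf
  rw [Submodule.span_le]
  rintro c ⟨hc, hpp, T, hT, hTne, h0⟩
  -- `f⁻¹T` is a proper closed subset of `X`
  have hZ : IsClosed (f.left.base ⁻¹' T) := hT.preimage f.left.continuous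
  have hZne : f.left.base ⁻¹' T ≠ Set.univ := by
    intro h
    refine hTne (Set.eq_univ_of_forall fun y ↦ ?_)
    obtain ⟨x, rfl⟩ := hf y
    exact (h ▸ Set.mem_univ x : x ∈ f.left.base ⁻¹' T)
  -- an orientation family (complex points are orientable); every one has Poincaré duality
  let μ : OrientationFamily := fun _ _ h ↦ Classical.choice (Motives.ComplexPoints.isOrientableOver ℂ h)
  have hμ : μ.HasPoincareDuality := OrientationFamily.hasPoincareDuality μ
  -- Deligne descent off `f⁻¹T`: `c = Σ g_* b`, `b` rational of type `(d, d)` on `W`, `dim W = 2m - e`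
  have hmem := mem_iSup_map_complexGysin_of_restrictCompl_eq_zero_of_ne_univ
    Deligne1974_ker_restrictCompl_eq_iSup_range_complexGysin_holds
    Voisin2025_hodgeClass_lift_complexGysin_holds
    Literature.AlgebraicGeometry.Resolution.Hironaka1964_projective_holds μ hμ hX hZ hZne hc hpp h0
  refine SetLike.le_def.1 ?_ hmem
  refine iSup_le fun d ↦ iSup_le fun e ↦ iSup_le fun hde ↦ iSup_le fun he ↦ iSup_le fun W ↦
    iSup_le fun m' ↦ iSup_le fun hm' ↦ iSup_le fun hW ↦ iSup_le fun g' ↦ ?_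
  rw [Submodule.map_le_iff_le_comap, Submodule.span_le]
  rintro b ⟨hb, hb'⟩
  rw [SetLike.mem_coe, Submodule.mem_comap]
  -- `b` is algebraic: the Hodge conjecture in dimension `m' = 2m - e < 2m`
  have halg : b ∈ algebraicClasses W d := hbelow (by omega : m' < 2 * m) hW d b hb hb'
  -- Gysin images of algebraic classes are algebraic, `d + 2m = m + m'`
  exact complexGysin_mem_algebraicClasses (gysinMap_restrictCompl_eq_zero_of_field ℂ) μ hμ hW hX g'
    (by omega) _ halg

end Summit.HodgeConjecture.HodgeConjecture.Theorems

end
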